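import Literature.Barriers.QuantumAdvantage.AaronsonChenOracleProofs
import Literature.Barriers.QuantumAdvantage.AaronsonChenLem53Holds
import HarnessLib

/-!
# Aaronson–Chen 2017, §5.3: `SampBQP^{TQBF,O} ⊆ SampBPP^{TQBF,O}` with probability `1` — the discharge

Proof file (D-0014: theorems only) closing the named fact
`aaronsonChen2017_thm51_sampBQP_subset` of `AaronsonChenOracle.lean`, which vendors

* S. Aaronson, L. Chen, *Complexity-theoretic foundations of quantum supremacy experiments*,
  CCC 2017, LIPIcs 79, 22:1–22:67 (doi:10.4230/LIPIcs.CCC.2017.22; arXiv:1612.05903)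
  [AaronsonChen2017], proof of the first part of **Thm. 5.1** (p. 21): "So
  `SampBQP^{TQBF,O} ⊆ SampBPP^{TQBF,O}` with probability `1`, which completes the proof."

The printed proof — Lemma 5.3 (the `SampBPP^{TQBF,O}` simulation `A` of a `SampBQP^{TQBF,O}`
algorithm `M`, `ε`-close with probability `≥ 1 − exp(−(2|x| + 1/ε))` over `O ∼ 𝒟_O`), the expected
number of bad pairs `(x, k)` being `Σ_n 2^n Σ_k exp(−(2n + 2^k)) = O(1)` so that with probability
`1` only finitely many pairs are bad (Borel–Cantelli), hard-wiring those, countably many `SampBQP`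
algorithms, and running `A_M` at accuracy `ε/2` — is formalized in the tree as
`aaronsonChen2017_thm51_sampBQP_subset_of_lem53` (`AaronsonChenOracleProofs.lean`); Lemma 5.3
itself is discharged as `aaronsonChen2017_lem53_holds` (`AaronsonChenLem53Holds.lean`, assembling
the machine half, the advice language in `PSPACE`, the physical predicates in `PSPACE`, the
`PSPACE`-completeness of `TQBF`, and the probabilistic half). This file composes the two.

## References

* [AaronsonChen2017] arXiv:1612.05903 / LIPIcs.CCC.2017.22, read via
  `lit read arxiv:1612.05903 --pages 20-24`: Thm. 5.1 and Lemma 5.3 (p. 21), the proof of the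
  first part of Thm. 5.1 (p. 21, "So `SampBQP^{TQBF,O} ⊆ SampBPP^{TQBF,O}` with probability 1"),
  proof of Lemma 5.3 (pp. 21–23).
-/

namespace Literature.Barriers.QuantumAdvantage

/-- **Aaronson–Chen 2017, Thm. 5.1, first part, the non-trivial inclusion** (discharge of the
named fact `aaronsonChen2017_thm51_sampBQP_subset`): for `O ∼ 𝒟_O`, with probability `1`,
`SampBQP^{TQBF,O} ⊆ SampBPP^{TQBF,O}` — in the tree's models,
`∀ᵐ O ∂acOracleMeasure, SampBQPRel (TQBF ⊕ O) ⊆ SampPRel (Oracle.ofLanguage (TQBF ⊕ O))`.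
Proof: the tree's reduction to Lemma 5.3 (`aaronsonChen2017_thm51_sampBQP_subset_of_lem53`:
Borel–Cantelli over the bad pairs, hard-wiring, countable intersection over algorithms, accuracy
halving) applied to the discharged Lemma 5.3 (`aaronsonChen2017_lem53_holds`).
[cite: AaronsonChen2017, §5.3 (p. 21, proof of the first part of Thm. 5.1) with Lemma 5.3 (p. 21; proof pp. 21–23)] -/
theorem aaronsonChen2017_thm51_sampBQP_subset_holds : aaronsonChen2017_thm51_sampBQP_subset :=
  aaronsonChen2017_thm51_sampBQP_subset_of_lem53 aaronsonChen2017_lem53_holds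

end Literature.Barriers.QuantumAdvantage
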